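import Mathlib
import Literature.MathematicalPhysics.KineticTheory.HardSphereEulerPrimitiveForm
import Literature.MathematicalPhysics.KineticTheory.HardSphereEulerSolutionGluing
import Summits.AtomisticToContinuum.HydrodynamicLimit.Theorems.JaynesSqueezeEntropicWeakStrongHS
import Summits.AtomisticToContinuum.HydrodynamicLimit.Theorems.RelayRaceLocalityNearConstantShortTimeHLEntropyFluxRemainderA
import HarnessLib

/-!
# Crux `NearConstantShortTimeHL` (stmt-AtomisticToContinuum-12502), line `small-tilt-domination`:
# the stub `entropyFlux_remainder_bound` (Dafermos' quadratic remainder for hard-sphere Euler)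

Along a classical hard-sphere Euler solution `(ρ, u, θ)` on `[0, T) × 𝕋³` with packing
`ρσ³ < η₀` on `[0, t] × 𝕋³` (low-density equation of state `hsExcessFreeEnergy = F` on `[0, η₀)`,
`F` analytic on `(-η₀, η₀)`), the log-profile rows
`λ⁰ = log ρ + g_σ(ρ) - 3/2 log(2πθ) - |u|²/(2θ)`, `λ = u/θ`, `λ⁴ = -1/θ` are, up to the additive
constant `-(5/2 + 3/2 log 2π)` in `λ⁰`, the entropy variables `Dh(U)` of the convex entropy
`h = -ρ s` of the system, so the relative flux
`Θ_r(W) - Θ_r(U) = ∂ₜλ·(W - U) + Σₖ ∂ₖλ·(Fₖ(W) - Fₖ(U))` has no linear part (Dafermos 1979,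
DiPerna 1979; Dafermos 2005, Thm 5.2.1) and is `O(|W - U|²)` for conserved states
`W = (ρ', m', E')` near `U = (ρ, ρu, E)`, uniformly on `[0, t] × 𝕋³`.

Proof: the pointwise algebra is the one already machine-checked for the support item
`EntropicWeakStrongHS` of route `JaynesSqueeze` (`relFlux_scaled_eq`, `coeff_bound`,
`remainder_bound`, `absorb_quadratic'` of `JaynesSqueezeEntropicWeakStrongHS*.lean`): it bounds
`θ²ρ |Θ_r(W) - Θ_r(U)|` by the squared PRIMITIVE increments `(ρ' - ρ)² + |m'/ρ' - u|² + (θ(W) - θ)²`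
on a compact set of states; here we (i) extend the packing bound from `[0, t]` to a slab
`[0, T')`, `t < T' ≤ T` (`exists_horizon_of_packing_lt`, part A) and restrict the solution
(`IsHardSphereEulerSolution.restrict`; the one-sided time derivatives within `[0, T)` and
`[0, T')` agree), (ii) put the `c₀`-neighbourhood of the solution values inside a compact subset
of the positivity/low-packing region, (iii) identify the rows' derivatives with the components
of the derivative of the entropy-variable triple, and (iv) bound the primitive increments by the
conserved ones (`prim_sq_le`, part A). No definitions, no named facts.
-/

noncomputable section

namespace Summit.AtomisticToContinuum.HydrodynamicLimit.Theorems.NearConstantShortTimeHL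

open scoped BigOperators ENNReal Topology InnerProductSpace
open MeasureTheory Set Filter
open Literature.MathematicalPhysics.KineticTheory Literature.Analysis.FluidPDE Literature.Analysis.FunctionSpaces
open Summit.AtomisticToContinuum.HydrodynamicLimit.Theorems.EntropicWeakStrong

/-! ### The stub -/

/-- **Dafermos' quadratic remainder for the hard-sphere Euler system** (registered stub
`entropyFlux_remainder_bound` of crux stmt-AtomisticToContinuum-12502, line
`small-tilt-domination`). Along a classical hard-sphere Euler solution with packing `< η₀` on
`[0, t] × 𝕋³` (low-density analytic equation of state), the relative flux of the log-profile rows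
`λ⁰, λ, λ⁴` between a conserved state `(ρ', m', E')` and the solution state `(ρ, ρu, E)(r, x)`,
`Θ_r(W) - Θ_r(U) = ∂ₜλ·(W - U) + Σₖ ∂ₖλ·(Fₖ(W) - Fₖ(U))`, is bounded by
`C ((ρ' - ρ)² + |m' - ρu|² + (E' - E)²)` whenever `|ρ' - ρ| + |m' - ρu| + |E' - E| ≤ c₀`, with
`C, c₀ > 0` uniform in `(r, x) ∈ [0, t] × 𝕋³`: the rows are the entropy variables of the convex
entropy `h = -ρs` up to a constant, so the linear part of the relative flux vanishes.
[cite: Dafermos2005, Thm 5.2.1] -/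
theorem entropyFlux_remainder_bound : ∀ {η₀ : ℝ} {F : ℝ → ℝ}, 0 < η₀ → AnalyticOnNhd ℝ F (Set.Ioo (-η₀) η₀) → Set.EqOn hsExcessFreeEnergy F (Set.Ico 0 η₀) → ∀ {σ T : ℝ}, 0 < σ → ∀ {ρ θ : ℝ → T3 → ℝ} {u : ℝ → T3 → V3}, IsHardSphereEulerSolution σ T ρ u θ → ∀ t ∈ Set.Ico 0 T, (∀ s ∈ Set.Icc 0 t, ∀ x, ρ s x * σ ^ 3 < η₀) → ∃ C : ℝ, 0 < C ∧ ∃ c₀ : ℝ, 0 < c₀ ∧ ∀ r ∈ Set.Icc 0 t, ∀ x : T3, ∀ (ρ' E' : ℝ) (m' : V3), |ρ' - ρ r x| + ‖m' - ρ r x • u r x‖ + |E' - totalEnergyDensity (ρ r x) (u r x) (θ r x)| ≤ c₀ → let g : ℝ → ℝ := fun a => hsExcessFreeEnergy (a * σ ^ 3) + a * σ ^ 3 * deriv hsExcessFreeEnergy (a * σ ^ 3); let lam0 : ℝ → T3 → ℝ := fun s y => Real.log (ρ s y) + g (ρ s y) - 3 / 2 * Real.log (2 * Real.pi * θ s y)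 - ‖u s y‖ ^ 2 / (2 * θ s y); let lam : ℝ → T3 → V3 := fun s y => (θ s y)⁻¹ • u s y; let lam4 : ℝ → T3 → ℝ := fun s y => -(θ s y)⁻¹; let θ' : ℝ := 2 / 3 * (E' / ρ' - ‖m'‖ ^ 2 / (2 * ρ' ^ 2)); let p' : ℝ := hsPressure σ ρ' θ'; let p : ℝ := hsPressure σ (ρ r x) (θ r x); let E : ℝ := totalEnergyDensity (ρ r x) (u r x) (θ r x); |Torus.timeDerivWithin (Set.Ico 0 T) lam0 r x * (ρ' - ρ r x) + (∑ j, Torus.timeDerivWithin (Set.Ico 0 T) lam r x j * (m' j - ρ r x * u r x j)) + Torus.timeDerivWithin (Set.Ico 0 T) lam4 r x * (E' - E) + (∑ k, Torus.partialDeriv k (lam0 r) x * (m' k - ρ r x * u r x k)) + (∑ k, ∑ j, Torus.partialDeriv k (lam r) x j * ((m' k * m' j / ρ' + (if k = j then p' else 0)) - (ρ r x * u r x k * u r x j + (if k = j then p else 0)))) + (∑ k, Torus.partialDeriv k (lam4 r) x * ((E' + p') * m' k / ρ' - (E + p) * u r x k))| ≤ C * ((ρ' - ρ r x) ^ 2 +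 ‖m' - ρ r x • u r x‖ ^ 2 + (E' - E) ^ 2) := by
  intro η₀ F hη₀ hFa hF σ T hσ ρ θ u hE t ht hpackt
  have hσ3 : 0 < σ ^ 3 := pow_pos hσ 3
  -- (i) a slab `[0, T')` beyond `t` with packing `< η₀`, and the restricted solution
  obtain ⟨T', htT', hT'T, hpack'⟩ := exists_horizon_of_packing_lt hE hσ ht hpackt
  have hE' : IsHardSphereEulerSolution σ T' ρ u θ := hE.restrict hT'T
  have ht' : t ∈ Ico 0 T' := ⟨ht.1, htT'⟩
  have htT'sub : Icc 0 t ⊆ Ico 0 T' := Icc_subset_Ico_right ht'.2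
  -- (ii) uniform bounds on `[0, t] × 𝕋³`
  obtain ⟨y₁, y₂, hy₁, hy₂, hρI, -⟩ := exists_packing_interval hE' hpack' ht'
    (isCompact_empty : IsCompact (∅ : Set (ℝ × V3 × ℝ))) (empty_subset _)
  obtain ⟨θmin, hθmin0, hθmin⟩ := HsEulerCalc.exists_pos_le_of_isSmoothSpaceTimeOn
    hE'.smooth_temperature hE'.temperature_pos ht'.2
  obtain ⟨Cu, hCu⟩ := hE'.smooth_velocity.exists_norm_le_of_isCompact isCompact_Icc htT'sub
  obtain ⟨Cθ, hCθ⟩ := hE'.smooth_temperature.exists_norm_le_of_isCompact isCompact_Icc htT'sub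
  obtain ⟨L, hL1, hLy₂, hLu, hLθ⟩ : ∃ L : ℝ, 1 ≤ L ∧ y₂ ≤ L ∧ Cu ≤ L ∧ Cθ ≤ L :=
    ⟨max (max 1 y₂) (max Cu Cθ), le_max_of_le_left (le_max_left _ _),
      le_max_of_le_left (le_max_right _ _), le_max_of_le_right (le_max_left _ _),
      le_max_of_le_right (le_max_right _ _)⟩
  have hρL : ∀ s ∈ Icc 0 t, ∀ y, |ρ s y| ≤ L := fun s hs y => by
    rw [abs_of_pos (hE'.density_pos s (htT'sub hs) y)]
    exact (hρI s hs y).2.trans hLy₂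
  have huL : ∀ s ∈ Icc 0 t, ∀ y, ‖u s y‖ ≤ L := fun s hs y => (hCu s hs y).trans hLu
  have hθL : ∀ s ∈ Icc 0 t, ∀ y, |θ s y| ≤ L := fun s hs y => by
    rw [← Real.norm_eq_abs]; exact (hCθ s hs y).trans hLθ
  have hη₂ : 0 < η₀ - y₂ * σ ^ 3 := sub_pos.2 hy₂
  -- (iii) the compact set of comparison states
  set R₁ : ℝ := y₂ + (η₀ - y₂ * σ ^ 3) / (2 * σ ^ 3) with hR₁
  set κ : ℝ := 3 / 2 * y₁ ^ 2 * θmin with hκ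
  have hκ0 : 0 < κ := by positivity
  set K : Set (ℝ × V3 × ℝ) := {W | y₁ / 2 ≤ W.1 ∧ W.1 ≤ R₁ ∧ ‖W.2.1‖ ≤ L ^ 2 + 1 ∧
    |W.2.2| ≤ 2 * L ^ 3 + 1 ∧ κ ≤ 2 * W.1 * W.2.2 - ‖W.2.1‖ ^ 2} with hK
  have hKc : IsCompact K := by
    refine Metric.isCompact_of_isClosed_isBounded ?_ ?_
    · simp only [hK, Set.setOf_and]
      refine (isClosed_le continuous_const continuous_fst).inter
        ((isClosed_le continuous_fst continuous_const).inter
        ((isClosed_le (continuous_snd.fst.norm) continuous_const).inter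
        ((isClosed_le (continuous_abs.comp continuous_snd.snd) continuous_const).inter
        (isClosed_le continuous_const (((continuous_const.mul continuous_fst).mul
          continuous_snd.snd).sub (continuous_snd.fst.norm.pow 2))))))
    · rw [isBounded_iff_forall_norm_le]
      refine ⟨R₁ + (L ^ 2 + 1) + (2 * L ^ 3 + 1), fun W hW => ?_⟩
      obtain ⟨h1, h2, h3, h4, -⟩ := hW
      have h0 : 0 < W.1 := by linarith
      rw [Prod.norm_def, Prod.norm_def, Real.norm_eq_abs, Real.norm_eq_abs, abs_of_pos h0]
      have k3 : (0:ℝ) ≤ L ^ 2 + 1 := by positivity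
      have k4 : (0:ℝ) ≤ 2 * L ^ 3 + 1 := by positivity
      exact max_le (by linarith) (max_le (by linarith) (by linarith))
  have hKΩ : K ⊆ {U : ℝ × V3 × ℝ | 0 < U.1 ∧ U.1 * σ ^ 3 < η₀ ∧ ‖U.2.1‖ ^ 2 < 2 * U.1 * U.2.2} := by
    intro W hW
    obtain ⟨h1, h2, -, -, h5⟩ := hW
    refine ⟨by linarith, ?_, by linarith⟩
    calc W.1 * σ ^ 3 ≤ R₁ * σ ^ 3 := mul_le_mul_of_nonneg_right h2 hσ3.le
      _ = (y₂ * σ ^ 3 + η₀) / 2 := by rw [hR₁]; field_simp; ring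
      _ < η₀ := by linarith
  -- (iv) the machine-checked pointwise algebra of `EntropicWeakStrongHS`
  obtain ⟨θo, hθo⟩ : ∃ θo : (ℝ × V3 × ℝ) → ℝ,
      θo = fun U => 2 / 3 * (U.2.2 / U.1 - ‖U.2.1‖ ^ 2 / (2 * U.1 ^ 2)) := ⟨_, rfl⟩
  obtain ⟨flux, hflux⟩ : ∃ flux : Fin 3 → (ℝ × V3 × ℝ) → (ℝ × V3 × ℝ),
      flux = fun i U => (U.2.1 i, (U.2.1 i / U.1) • U.2.1 +
        hsPressure σ U.1 (θo U) • EuclideanSpace.single i (1 : ℝ),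
        (U.2.2 + hsPressure σ U.1 (θo U)) * U.2.1 i / U.1) := ⟨_, rfl⟩
  obtain ⟨pair, hpair⟩ : ∃ pair : (ℝ × V3 × ℝ) → (ℝ × V3 × ℝ) → ℝ,
      pair = fun L U => L.1 * U.1 + (∑ j, L.2.1 j * U.2.1 j) + L.2.2 * U.2.2 := ⟨_, rfl⟩
  obtain ⟨B, hB0, hB⟩ := coeff_bound hE' hσ hFa hpack' θo hθo ht' hKc hKΩ
  obtain ⟨CR, hCR0, hCR⟩ := remainder_bound hE' hσ hFa hF hpack' ht' hKc hKΩ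
  -- the constants
  set CL : ℝ := 1 + 8 * L ^ 2 / y₁ ^ 2 + 2400 * L ^ 6 / y₁ ^ 4 with hCL
  set c₀ : ℝ := min (min (min 1 (y₁ / 2)) ((η₀ - y₂ * σ ^ 3) / (2 * σ ^ 3)))
    (3 * y₁ ^ 2 * θmin / (22 * L ^ 3)) with hc₀
  have hc₀1 : c₀ ≤ 1 := (min_le_left _ _).trans ((min_le_left _ _).trans (min_le_left _ _))
  have hc₀y : c₀ ≤ y₁ / 2 := (min_le_left _ _).trans ((min_le_left _ _).trans (min_le_right _ _))
  have hc₀η : c₀ ≤ (η₀ - y₂ * σ ^ 3) / (2 * σ ^ 3) := (min_le_left _ _).trans (min_le_right _ _)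
  have hc₀κ : c₀ ≤ 3 * y₁ ^ 2 * θmin / (22 * L ^ 3) := min_le_right _ _
  refine ⟨B * (1 + CR) * CL / (θmin ^ 2 * y₁) + 1, by positivity, c₀, by positivity, ?_⟩
  intro r hr x ρ' E' m' hclose g lam0 lam lam4 θ' p' p E
  have hrT' : r ∈ Ico 0 T' := htT'sub hr
  have hρ0 : 0 < ρ r x := hE'.density_pos r hrT' x
  have hθ0 : 0 < θ r x := hE'.temperature_pos r hrT' x
  obtain ⟨hη, hη'⟩ := packing_mem hE' hσ hpack' hrT' x
  -- the increments are small
  have ha1 : |ρ' - ρ r x| ≤ c₀ := by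
    linarith only [hclose, norm_nonneg (m' - ρ r x • u r x),
      abs_nonneg (E' - totalEnergyDensity (ρ r x) (u r x) (θ r x))]
  have hn1 : ‖m' - ρ r x • u r x‖ ≤ c₀ := by
    linarith only [hclose, abs_nonneg (ρ' - ρ r x),
      abs_nonneg (E' - totalEnergyDensity (ρ r x) (u r x) (θ r x))]
  have he1 : |E' - totalEnergyDensity (ρ r x) (u r x) (θ r x)| ≤ c₀ := by
    linarith only [hclose, abs_nonneg (ρ' - ρ r x), norm_nonneg (m' - ρ r x • u r x)]
  have hρ'lo : y₁ / 2 ≤ ρ' := by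
    have h := (abs_le.1 ha1).1
    linarith only [h, hc₀y, (hρI r hr x).1]
  have hρ'0 : 0 < ρ' := by linarith only [hρ'lo, hy₁]
  -- (v) the comparison state lies in `K`
  have hEabs : |totalEnergyDensity (ρ r x) (u r x) (θ r x)| ≤ 2 * L ^ 3 :=
    abs_totalEnergyDensity_le hL1 (hρL r hr x) (huL r hr x) (hθL r hr x)
  have hVK : ((ρ', m', E') : ℝ × V3 × ℝ) ∈ K := by
    simp only [hK, Set.mem_setOf_eq]
    refine ⟨hρ'lo, ?_, ?_, ?_, ?_⟩
    · have h := (abs_le.1 ha1).2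
      linarith only [h, hc₀η, (hρI r hr x).2]
    · calc ‖m'‖ = ‖ρ r x • u r x + (m' - ρ r x • u r x)‖ := by rw [add_sub_cancel]
        _ ≤ ‖ρ r x • u r x‖ + ‖m' - ρ r x • u r x‖ := norm_add_le _ _
        _ ≤ L ^ 2 + 1 := by
          rw [norm_smul, Real.norm_eq_abs]
          have h := mul_le_mul (hρL r hr x) (huL r hr x) (norm_nonneg _) (by linarith only [hL1])
          linarith only [h, hn1, hc₀1, (by ring : L * L = L ^ 2)]
    · calc |E'| = |totalEnergyDensity (ρ r x) (u r x) (θ r x) +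
            (E' - totalEnergyDensity (ρ r x) (u r x) (θ r x))| := by rw [add_sub_cancel]
        _ ≤ |totalEnergyDensity (ρ r x) (u r x) (θ r x)| +
            |E' - totalEnergyDensity (ρ r x) (u r x) (θ r x)| := abs_add_le _ _
        _ ≤ 2 * L ^ 3 + 1 := by linarith only [hEabs, he1, hc₀1]
    · have hι : |⟪u r x, m' - ρ r x • u r x⟫_ℝ| ≤ L * ‖m' - ρ r x • u r x‖ :=
        (abs_real_inner_le_norm _ _).trans
          (mul_le_mul_of_nonneg_right (huL r hr x) (norm_nonneg _))
      have hX := abs_fluct_le (a := ρ' - ρ r x) hL1 (hρL r hr x) hEabs hι (norm_nonneg _)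
        (he1.trans hc₀1) (hn1.trans hc₀1)
      have hexp := two_mul_energy_sub_norm_sq (ρ r x) (θ r x) ρ' E' (u r x) m'
      have hmain : 3 * y₁ ^ 2 * θmin ≤ 3 * ρ r x ^ 2 * θ r x := by
        have h1 : y₁ ^ 2 ≤ ρ r x ^ 2 := pow_le_pow_left₀ hy₁.le (hρI r hr x).1 2
        have h2 := mul_le_mul h1 (hθmin r hr x) hθmin0.le (by positivity)
        linarith only [h2]
      have hsmallκ : 11 * L ^ 3 * (|ρ' - ρ r x| + ‖m' - ρ r x • u r x‖ +
          |E' - totalEnergyDensity (ρ r x) (u r x) (θ r x)|) ≤ 3 / 2 * y₁ ^ 2 * θmin := by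
        have h1 : 11 * L ^ 3 * c₀ ≤ 3 / 2 * y₁ ^ 2 * θmin := by
          have h := (le_div_iff₀ (by positivity : (0:ℝ) < 22 * L ^ 3)).1 hc₀κ
          linarith only [h]
        have h2 : 11 * L ^ 3 * (|ρ' - ρ r x| + ‖m' - ρ r x • u r x‖ +
            |E' - totalEnergyDensity (ρ r x) (u r x) (θ r x)|) ≤ 11 * L ^ 3 * c₀ :=
          mul_le_mul_of_nonneg_left hclose (by positivity)
        exact h2.trans h1
      show κ ≤ 2 * ρ' * E' - ‖m'‖ ^ 2
      rw [hexp, hκ]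
      have h := (abs_le.1 hX).1
      linarith only [h, hmain, hsmallκ]
  set V : ℝ × V3 × ℝ := (ρ', m', E') with hV
  have hV1 : 0 < V.1 := hρ'0
  have hid := relFlux_scaled_eq hE' hσ hFa hF hpack' θo hθo flux hflux pair hpair hrT' x hV1
  have hQ := absorb_quadratic' (b0 := V.1⁻¹ * V.2.1 0 - u r x 0) (b1 := V.1⁻¹ * V.2.1 1 - u r x 1)
    (b2 := V.1⁻¹ * V.2.1 2 - u r x 2) (c := θo V - θ r x) hCR0 (hB r hr x V hVK) (hCR r hr x V hVK)
  rw [← hid] at hQ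
  have hpos : 0 < θ r x ^ 2 * ρ r x := by positivity
  rw [abs_mul, abs_of_pos hpos] at hQ
  have key₁ := (le_div_iff₀' hpos).2 hQ
  -- (vi) primitive increments are dominated by conserved increments
  have hSq : (V.1 - ρ r x) ^ (2:ℕ) + ((V.1⁻¹ * V.2.1 0) - u r x 0) ^ (2:ℕ) +
      ((V.1⁻¹ * V.2.1 1) - u r x 1) ^ (2:ℕ) + ((V.1⁻¹ * V.2.1 2) - u r x 2) ^ (2:ℕ) +
      (θo V - θ r x) ^ (2:ℕ) ≤ CL * ((ρ' - ρ r x) ^ 2 + ‖m' - ρ r x • u r x‖ ^ 2 +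
        (E' - totalEnergyDensity (ρ r x) (u r x) (θ r x)) ^ 2) := by
    have h := prim_sq_le (ρ' := ρ') (m' := m') (E' := E') hL1 hy₁ hρ'lo (hρL r hr x) (huL r hr x)
      (hθL r hr x) (hclose.trans hc₀1)
    simpa only [hθo, hV, hCL] using h
  have key₂ : B * (1 + CR) * ((V.1 - ρ r x) ^ (2:ℕ) + ((V.1⁻¹ * V.2.1 0) - u r x 0) ^ (2:ℕ) +
      ((V.1⁻¹ * V.2.1 1) - u r x 1) ^ (2:ℕ) + ((V.1⁻¹ * V.2.1 2) - u r x 2) ^ (2:ℕ) +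
      (θo V - θ r x) ^ (2:ℕ)) / (θ r x ^ 2 * ρ r x) ≤ (B * (1 + CR) * CL / (θmin ^ 2 * y₁) + 1) *
        ((ρ' - ρ r x) ^ 2 + ‖m' - ρ r x • u r x‖ ^ 2 +
          (E' - totalEnergyDensity (ρ r x) (u r x) (θ r x)) ^ 2) := by
    set Q : ℝ := (ρ' - ρ r x) ^ 2 + ‖m' - ρ r x • u r x‖ ^ 2 +
      (E' - totalEnergyDensity (ρ r x) (u r x) (θ r x)) ^ 2 with hQdef
    have hQ0 : 0 ≤ Q := by positivity
    have hBCR : 0 ≤ B * (1 + CR) := by positivity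
    have hden : θmin ^ 2 * y₁ ≤ θ r x ^ 2 * ρ r x := by
      have h1 : θmin ^ 2 ≤ θ r x ^ 2 := pow_le_pow_left₀ hθmin0.le (hθmin r hr x) 2
      exact mul_le_mul h1 (hρI r hr x).1 hy₁.le (by positivity)
    have h2 := div_le_div_of_nonneg_right (mul_le_mul_of_nonneg_left hSq hBCR) hpos.le
    refine h2.trans ?_
    have h3 : B * (1 + CR) * (CL * Q) / (θ r x ^ 2 * ρ r x) ≤
        B * (1 + CR) * (CL * Q) / (θmin ^ 2 * y₁) :=
      div_le_div_of_nonneg_left (by positivity) (by positivity) hden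
    refine h3.trans ?_
    have h4 : B * (1 + CR) * (CL * Q) / (θmin ^ 2 * y₁) = B * (1 + CR) * CL / (θmin ^ 2 * y₁) * Q := by
      ring
    rw [h4]
    nlinarith only [hQ0, (by positivity : 0 ≤ B * (1 + CR) * CL / (θmin ^ 2 * y₁))]
  have key := key₁.trans key₂
  -- (vii) the one-sided time derivatives within `[0, T)` are those within `[0, T')`
  have hset := Ico_eventuallyEq_Ico_of_lt_of_le (hr.2.trans_lt htT') hT'T
  have e0 : Torus.timeDerivWithin (Set.Ico 0 T) lam0 r x = Torus.timeDerivWithin (Ico 0 T') lam0 r x :=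
    derivWithin_congr_set hset
  have e1 : Torus.timeDerivWithin (Set.Ico 0 T) lam r x = Torus.timeDerivWithin (Ico 0 T') lam r x :=
    derivWithin_congr_set hset
  have e4 : Torus.timeDerivWithin (Set.Ico 0 T) lam4 r x = Torus.timeDerivWithin (Ico 0 T') lam4 r x :=
    derivWithin_congr_set hset
  rw [e0, e1, e4]
  refine Eq.trans_le ?_ key
  congr 1
  -- (viii) the rows are the entropy variables up to a constant: identify the derivatives
  set ΛT : ℝ → T3 → ℝ × V3 × ℝ := fun s y => ((-(3 / 2 * Real.log (θ s y) - Real.log (ρ s y) -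
      hsExcessFreeEnergy (ρ s y * σ ^ 3)) + 5 / 2 - ‖u s y‖ ^ 2 / (2 * θ s y) +
      ρ s y * σ ^ 3 * deriv hsExcessFreeEnergy (ρ s y * σ ^ 3) : ℝ),
      (θ s y)⁻¹ • u s y, -(θ s y)⁻¹) with hΛT
  set ΛS : T3 → ℝ × V3 × ℝ := fun y => ((-(3 / 2 * Real.log (θ r y) - Real.log (ρ r y) -
      hsExcessFreeEnergy (ρ r y * σ ^ 3)) + 5 / 2 - ‖u r y‖ ^ 2 / (2 * θ r y) +
      ρ r y * σ ^ 3 * deriv hsExcessFreeEnergy (ρ r y * σ ^ 3) : ℝ),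
      (θ r y)⁻¹ • u r y, -(θ r y)⁻¹) with hΛS
  have hU' : UniqueDiffOn ℝ (Ico (0:ℝ) T') := uniqueDiffOn_Ico 0 T'
  have hshift : ∀ s ∈ Ico 0 T', ∀ y, lam0 s y = (ΛT s y).1 - (5 / 2 + 3 / 2 * Real.log (2 * Real.pi)) := by
    intro s hs y
    simp only [lam0, g, hΛT]
    rw [Real.log_mul (by positivity) (hE'.temperature_pos s hs y).ne']
    ring
  -- time rows
  have hdT := hasDerivWithinAt_entropyVar (hE'.smooth_density.hasDerivWithinAt_slice hrT' x)
    (hE'.smooth_temperature.hasDerivWithinAt_slice hrT' x)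
    (hE'.smooth_velocity.hasDerivWithinAt_slice hrT' x) hθ0.ne' (hasDerivAt_logPlusG hFa hρ0 hη')
  obtain ⟨D, hD⟩ : ∃ D, HasDerivWithinAt (fun s => ΛT s x) D (Ico 0 T') r :=
    ⟨_, hdT.congr (fun s hs => by simp only [hΛT, entropyVar_fst_eq hE' hσ hF hpack' hs x])
      (by simp only [hΛT, entropyVar_fst_eq hE' hσ hF hpack' hrT' x])⟩
  have hXT : Torus.timeDerivWithin (Ico 0 T') ΛT r x = D := hD.derivWithin (hU' r hrT')
  have hfT := (ContinuousLinearMap.fst ℝ ℝ (V3 × ℝ)).hasFDerivAt.comp_hasDerivWithinAt r hD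
  have hsT := (ContinuousLinearMap.snd ℝ ℝ (V3 × ℝ)).hasFDerivAt.comp_hasDerivWithinAt r hD
  have hsfT := (ContinuousLinearMap.fst ℝ V3 ℝ).hasFDerivAt.comp_hasDerivWithinAt r hsT
  have hssT := (ContinuousLinearMap.snd ℝ V3 ℝ).hasFDerivAt.comp_hasDerivWithinAt r hsT
  have t0 : Torus.timeDerivWithin (Ico 0 T') lam0 r x = (Torus.timeDerivWithin (Ico 0 T') ΛT r x).1 := by
    rw [hXT]
    have h : HasDerivWithinAt (fun s => lam0 s x) ((ContinuousLinearMap.fst ℝ ℝ (V3 × ℝ)) D)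
        (Ico 0 T') r :=
      (hfT.sub_const (5 / 2 + 3 / 2 * Real.log (2 * Real.pi))).congr
        (fun s hs => by rw [hshift s hs x]; rfl) (by rw [hshift r hrT' x]; rfl)
    exact h.derivWithin (hU' r hrT')
  have t1 : Torus.timeDerivWithin (Ico 0 T') lam r x = (Torus.timeDerivWithin (Ico 0 T') ΛT r x).2.1 := by
    rw [hXT]
    exact hsfT.derivWithin (hU' r hrT')
  have t4 : Torus.timeDerivWithin (Ico 0 T') lam4 r x = (Torus.timeDerivWithin (Ico 0 T') ΛT r x).2.2 := by
    rw [hXT]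
    exact hssT.derivWithin (hU' r hrT')
  -- space rows
  have hρ1 : Torus.IsContDiff 1 (ρ r) := (hE'.smooth_density.isSmooth_slice hrT').isContDiff (by simp)
  have hθ1 : Torus.IsContDiff 1 (θ r) :=
    (hE'.smooth_temperature.isSmooth_slice hrT').isContDiff (by simp)
  have hu1 : Torus.IsContDiff 1 (u r) := (hE'.smooth_velocity.isSmooth_slice hrT').isContDiff (by simp)
  have hDS : ∀ k : Fin 3, ∃ D' : ℝ × V3 × ℝ,
      HasDerivAt (fun s : ℝ => ΛS (x + Torus.proj (s • EuclideanSpace.single k (1 : ℝ)))) D' 0 := by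
    intro k
    have cρ := HsEulerCalc.hasDerivAt_coordLine hρ1 x k
    have cθ := HsEulerCalc.hasDerivAt_coordLine hθ1 x k
    have cu : HasDerivAt (fun s : ℝ => u r (x + Torus.proj (s • EuclideanSpace.single k (1 : ℝ))))
        (Torus.partialDeriv k (u r) x) 0 := by
      have h := Torus.hasDerivAt_comp_add_proj_smul hu1 x (EuclideanSpace.single k (1 : ℝ)) 0
      simp only [zero_smul, Torus.proj_zero, add_zero] at h
      exact h
    have hθx : θ r (x + Torus.proj ((0 : ℝ) • EuclideanSpace.single k (1 : ℝ))) ≠ 0 := by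
      simp only [zero_smul, Torus.proj_zero, add_zero]
      exact hθ0.ne'
    have hΦ : HasDerivAt (fun y => Real.log y + F (y * σ ^ 3) + y * σ ^ 3 * deriv F (y * σ ^ 3))
        ((ρ r x)⁻¹ + 2 * σ ^ 3 * deriv F (ρ r x * σ ^ 3) +
          ρ r x * σ ^ 6 * deriv (deriv F) (ρ r x * σ ^ 3))
        (ρ r (x + Torus.proj ((0 : ℝ) • EuclideanSpace.single k (1 : ℝ)))) := by
      simp only [zero_smul, Torus.proj_zero, add_zero]
      exact hasDerivAt_logPlusG hFa hρ0 hη'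
    have hderiv := hasDerivWithinAt_entropyVar cρ.hasDerivWithinAt cθ.hasDerivWithinAt
      cu.hasDerivWithinAt hθx hΦ (S := univ)
    simp only [zero_smul, Torus.proj_zero, add_zero] at hderiv
    exact ⟨_, (hderiv.congr (fun s _ => by simp only [hΛS, entropyVar_fst_eq hE' hσ hF hpack' hrT'])
      (by simp only [hΛS, entropyVar_fst_eq hE' hσ hF hpack' hrT'])).hasDerivAt Filter.univ_mem⟩
  have s0 : ∀ k, Torus.partialDeriv k (lam0 r) x = (Torus.partialDeriv k ΛS x).1 := by
    intro k
    obtain ⟨D', hD'⟩ := hDS k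
    rw [show Torus.partialDeriv k ΛS x = D' from hD'.deriv]
    have hfun : (fun s : ℝ => lam0 r (x + Torus.proj (s • EuclideanSpace.single k (1 : ℝ)))) =
        fun s => (ΛS (x + Torus.proj (s • EuclideanSpace.single k (1 : ℝ)))).1 -
          (5 / 2 + 3 / 2 * Real.log (2 * Real.pi)) := by
      funext s
      rw [hshift r hrT']
    have h := ((ContinuousLinearMap.fst ℝ ℝ (V3 × ℝ)).hasFDerivAt.comp_hasDerivAt (0:ℝ) hD').sub_const
      (5 / 2 + 3 / 2 * Real.log (2 * Real.pi))
    unfold Torus.partialDeriv Torus.lineDeriv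
    rw [hfun]
    exact h.deriv
  have s1 : ∀ k, Torus.partialDeriv k (lam r) x = (Torus.partialDeriv k ΛS x).2.1 := by
    intro k
    obtain ⟨D', hD'⟩ := hDS k
    rw [show Torus.partialDeriv k ΛS x = D' from hD'.deriv]
    exact ((ContinuousLinearMap.fst ℝ V3 ℝ).hasFDerivAt.comp_hasDerivAt (0:ℝ)
      ((ContinuousLinearMap.snd ℝ ℝ (V3 × ℝ)).hasFDerivAt.comp_hasDerivAt (0:ℝ) hD')).deriv
  have s4 : ∀ k, Torus.partialDeriv k (lam4 r) x = (Torus.partialDeriv k ΛS x).2.2 := by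
    intro k
    obtain ⟨D', hD'⟩ := hDS k
    rw [show Torus.partialDeriv k ΛS x = D' from hD'.deriv]
    exact ((ContinuousLinearMap.snd ℝ V3 ℝ).hasFDerivAt.comp_hasDerivAt (0:ℝ)
      ((ContinuousLinearMap.snd ℝ ℝ (V3 × ℝ)).hasFDerivAt.comp_hasDerivAt (0:ℝ) hD')).deriv
  -- (ix) both sides are now the same pairing
  rw [t0, t1, t4]
  simp only [s0, s1, s4]
  have h01 : ¬ ((0 : Fin 3) = 1) := by decide
  have h02 : ¬ ((0 : Fin 3) = 2) := by decide
  have h10 : ¬ ((1 : Fin 3) = 0) := by decide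
  have h12 : ¬ ((1 : Fin 3) = 2) := by decide
  have h20 : ¬ ((2 : Fin 3) = 0) := by decide
  have h21 : ¬ ((2 : Fin 3) = 1) := by decide
  have hρne : ρ r x ≠ 0 := hρ0.ne'
  have hρ'ne : ρ' ≠ 0 := hρ'0.ne'
  simp only [hpair, hflux, thetaOf_consVar θo hθo hρne]
  simp only [hθo, hV, θ', p', p, E, Prod.fst_sub, Prod.snd_sub, PiLp.sub_apply, PiLp.add_apply,
    PiLp.smul_apply, PiLp.single_apply, smul_eq_mul, mul_ite, mul_one, mul_zero,
    Fin.sum_univ_three, Fin.isValue, h01, h02, h10, h12, h20, h21, if_true, if_false]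
  field_simp
  ring

end Summit.AtomisticToContinuum.HydrodynamicLimit.Theorems.NearConstantShortTimeHL

end
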